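import Literature.Topology.FourManifolds.TrisectionsHeegaardGerm
import Mathlib.Analysis.SpecialFunctions.SmoothTransition
import HarnessLib

/-!
# The Heegaard germ globalised: a smooth function on the `4`-manifold which is the tube
# function near the attaching link and a constant elsewhere near the level

Topic `Literature/Topology/FourManifolds`; step D2 of a Morse-theoretic construction of
Gay–Kirby's trisection for the fact seat
`provefact-Literature.Topology.FourManifolds.exists_isBalancedGKTrisection` (Gay–Kirby 2016,
Thm. 4 via §4, Lemma 14).  Everything in this file is **proved**; the definitions are explicit
functions (two one-variable cut-offs, a system of Milnor charts as a structure, and the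
globalised function), no named facts.

Given a smooth `f` on a `4`-manifold `X`, a level `a`, and a finite system `T` of Milnor charts
`e_j` about points `c_j` with `f = f(c_j) + Q₂(e_j - e_j c_j)` on pairwise disjoint chart
domains and `f(c_j) = a + η` (the critical points of index `2` at one level, `Y = f⁻¹(a)` the
level just below them), the function
`F = (1 + 4δ) + Σ_j 𝟙_{source e_j} · χ(f - a) · (Ψ(𝒯(e_j - e_j c_j)) - (1 + 4δ))`
— `𝒯` the tube function of `TrisectionsTubeModel.lean`, `Ψ = HeegaardGlobal.sat δ` the identity
below `1 + 7δ/2` and the constant `1 + 4δ` above `1 + 5δ`, `χ = HeegaardGlobal.cut η` a bump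
equal to `1` on `[-η/4, η/4]` and vanishing off `(-η/2, η/2)` — is smooth on `X`
(`TubeSystem.contMDiff_heegaardFn`: each summand is smooth on its chart domain and supported in
a compact subset of it), and along `Y`:

* where `F < 1 + 7δ/2` it has the germ of the tube function of one of the charts
  (`TubeSystem.exists_eventuallyEq_tube_of_lt`), so that `HeegaardGerm` reads off the critical
  points of `F|Y` there (the four axis points of each attaching circle, nondegenerate of indices
  `0, 0, 1, 1`, values `1 - ε` and `1`);
* off the chart domains it is locally the constant `1 + 4δ`;
* `1 - ε ≤ F ≤ 1 + 5δ` on `Y`.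

This is the input `f₀` of the relative Morse approximation `exists_isMorse_eqOn_close`
(`MorseRelativeExistence.lean`) with `V₁ = {F < 1 + 2δ}`, `V₂ = {F < 1 + 3δ}` in the
construction of the Heegaard function of Gay–Kirby's Lemma 14.

## References

* D. Gay, R. Kirby, *Trisecting 4-manifolds*, Geom. Topol. 20 (2016), §4, Lemma 14 and proof
  of Thm. 4. [GayKirby2016]
* J. Milnor, *Lectures on the h-cobordism theorem* (1965), Def. 3.1. [MilnorHCobordism1965]
-/

open scoped Manifold ContDiff Topology
open Set Function Filter Metric

noncomputable section

universe u

namespace Literature.Topology.FourManifolds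

/-- Local notation: `𝔼 n` is the model Euclidean space `EuclideanSpace ℝ (Fin n)`. -/
local notation "𝔼 " n:arg => EuclideanSpace ℝ (Fin n)

namespace HeegaardGlobal

open RadialThickening (proj bsq bsq_apply bsq_nonneg)
open TubeModel

/-! ### Two one-variable cut-offs -/

/-- **The saturation** `Ψ(t) = t + (1 + 4δ - t) S((t - (1 + 7δ/2)) / (3δ/2))`, `S` the smooth
transition: the identity for `t ≤ 1 + 7δ/2`, the constant `1 + 4δ` for `t ≥ 1 + 5δ`. [folklore] -/
def sat (δ t : ℝ) : ℝ :=
  t + (1 + 4 * δ - t) * Real.smoothTransition ((t - (1 + 7 / 2 * δ)) / (3 / 2 * δ))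

/-- `Ψ = id` below `1 + 7δ/2`. [folklore] -/
theorem sat_of_le {δ t : ℝ} (hδ : 0 < δ) (ht : t ≤ 1 + 7 / 2 * δ) : sat δ t = t := by
  rw [sat, Real.smoothTransition.zero_of_nonpos, mul_zero, add_zero]
  exact div_nonpos_of_nonpos_of_nonneg (by linarith) (by positivity)

/-- `Ψ = 1 + 4δ` above `1 + 5δ`. [folklore] -/
theorem sat_of_ge {δ t : ℝ} (hδ : 0 < δ) (ht : 1 + 5 * δ ≤ t) : sat δ t = 1 + 4 * δ := by
  rw [sat, Real.smoothTransition.one_of_one_le, mul_one, add_sub_cancel]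
  rw [le_div_iff₀ (by positivity)]
  linarith

/-- `Ψ(t)` lies between `t` and `1 + 4δ` (a convex combination). [folklore] -/
theorem min_le_sat (δ t : ℝ) : min t (1 + 4 * δ) ≤ sat δ t := by
  have h0 := Real.smoothTransition.nonneg ((t - (1 + 7 / 2 * δ)) / (3 / 2 * δ))
  have h1 := Real.smoothTransition.le_one ((t - (1 + 7 / 2 * δ)) / (3 / 2 * δ))
  rw [sat]
  rcases le_total t (1 + 4 * δ) with h | h
  · rw [min_eq_left h]; nlinarith
  · rw [min_eq_right h]; nlinarith

/-- `Ψ(t)` lies between `t` and `1 + 4δ`. [folklore] -/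
theorem sat_le_max (δ t : ℝ) : sat δ t ≤ max t (1 + 4 * δ) := by
  have h0 := Real.smoothTransition.nonneg ((t - (1 + 7 / 2 * δ)) / (3 / 2 * δ))
  have h1 := Real.smoothTransition.le_one ((t - (1 + 7 / 2 * δ)) / (3 / 2 * δ))
  rw [sat]
  rcases le_total t (1 + 4 * δ) with h | h
  · rw [max_eq_right h]; nlinarith
  · rw [max_eq_left h]; nlinarith

/-- `Ψ ≤ 1 + 5δ`. [folklore] -/
theorem sat_le {δ : ℝ} (hδ : 0 < δ) (t : ℝ) : sat δ t ≤ 1 + 5 * δ := by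
  rcases le_or_gt (1 + 5 * δ) t with h | h
  · rw [sat_of_ge hδ h]; linarith
  · exact (sat_le_max δ t).trans (max_le h.le (by linarith))

/-- If `Ψ(t) < 1 + 7δ/2` then `t < 1 + 7δ/2` (so `Ψ = id` near `t`). [folklore] -/
theorem lt_of_sat_lt {δ t : ℝ} (hδ : 0 < δ) (h : sat δ t < 1 + 7 / 2 * δ) : t < 1 + 7 / 2 * δ := by
  by_contra ht
  have := min_le_sat δ t
  rw [min_def] at this
  split_ifs at this with h' <;> linarith

/-- `Ψ` is smooth (`δ ≠ 0`). [folklore] -/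
theorem contDiff_sat {n : ℕ∞} (δ : ℝ) : ContDiff ℝ n (sat δ) := by
  have h : ContDiff ℝ n fun t : ℝ => (t - (1 + 7 / 2 * δ)) / (3 / 2 * δ) :=
    (contDiff_id.sub contDiff_const).div_const _
  exact contDiff_id.add ((contDiff_const.sub contDiff_id).mul (Real.smoothTransition.contDiff.comp h))

/-- **The cut-off** `χ(t) = S((η/2 - t)(4/η)) S((η/2 + t)(4/η))`: `1` on `[-η/4, η/4]`, `0` off
`(-η/2, η/2)`. [folklore] -/
def cut (η t : ℝ) : ℝ :=
  Real.smoothTransition ((η / 2 - t) * (4 / η)) * Real.smoothTransition ((η / 2 + t) * (4 / η))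

/-- `χ = 1` on `[-η/4, η/4]`. [folklore] -/
theorem cut_of_abs_le {η t : ℝ} (hη : 0 < η) (ht : |t| ≤ η / 4) : cut η t = 1 := by
  rw [abs_le] at ht
  have h4 : (η / 4) * (4 / η) = 1 := by field_simp
  have h1 : 1 ≤ (η / 2 - t) * (4 / η) := by
    rw [← h4]; exact mul_le_mul_of_nonneg_right (by linarith) (by positivity)
  have h2 : 1 ≤ (η / 2 + t) * (4 / η) := by
    rw [← h4]; exact mul_le_mul_of_nonneg_right (by linarith) (by positivity)
  rw [cut, Real.smoothTransition.one_of_one_le h1, Real.smoothTransition.one_of_one_le h2, mul_one]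

/-- `χ = 0` off `(-η/2, η/2)`. [folklore] -/
theorem cut_of_le_abs {η t : ℝ} (hη : 0 < η) (ht : η / 2 ≤ |t|) : cut η t = 0 := by
  rw [cut]
  rcases le_abs'.1 ht with h | h
  · rw [Real.smoothTransition.zero_of_nonpos (x := (η / 2 + t) * (4 / η)), mul_zero]
    exact mul_nonpos_of_nonpos_of_nonneg (by linarith) (by positivity)
  · rw [Real.smoothTransition.zero_of_nonpos (x := (η / 2 - t) * (4 / η)), zero_mul]
    exact mul_nonpos_of_nonpos_of_nonneg (by linarith) (by positivity)

/-- Where `χ ≠ 0`, `|t| < η/2`. [folklore] -/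
theorem abs_lt_of_cut_ne_zero {η t : ℝ} (hη : 0 < η) (h : cut η t ≠ 0) : |t| < η / 2 := by
  by_contra h'
  exact h (cut_of_le_abs hη (not_lt.1 h'))

/-- `χ` is smooth. [folklore] -/
theorem contDiff_cut {n : ℕ∞} (η : ℝ) : ContDiff ℝ n (cut η) :=
  (Real.smoothTransition.contDiff.comp ((contDiff_const.sub contDiff_id).mul contDiff_const)).mul
    (Real.smoothTransition.contDiff.comp ((contDiff_const.add contDiff_id).mul contDiff_const))

end HeegaardGlobal

/-! ### Systems of Milnor charts about the index-`2` critical points of one level -/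

open RadialThickening (proj bsq bsq_apply bsq_nonneg)
open TubeModel HeegaardGlobal

variable {X : Type u} [TopologicalSpace X] [ChartedSpace (𝔼 4) X]

/-- **A system of Milnor charts at the level `a + η`** for `f : X → ℝ`: finitely many charts
`e_j` of the `C^∞` maximal atlas about points `c_j` with `f(c_j) = a + η`, pairwise disjoint
domains, Milnor's normal form `f = f(c_j) + Q₂(e_j - e_j c_j)` of index `2` on each domain
(Milnor 1965, Def. 3.1 (2), as produced by `IsGradientLike.exists_chart_morseIndex`), and a common
radius `R` with `B̄(e_j c_j, R) ⊆ target e_j` against which `η` is small (`4η ≤ R²`).  In the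
proof of Gay–Kirby's Thm. 4 these are the charts of the `2`-handles, `Y = f⁻¹(a)` is `∂X₁`, and
`{e_j - e_j c_j ∈ {y = 0}} ∩ Y` is the attaching link. [cite: MilnorHCobordism1965, Def. 3.1] [cite: GayKirby2016, §4, proof of Thm. 4] -/
structure TubeSystem [IsManifold (𝓡 4) ∞ X] (f : X → ℝ) (a η : ℝ) (ι : Type) [Fintype ι] where
  /-- The charts. -/
  chart : ι → OpenPartialHomeomorph X (𝔼 4)
  /-- Their centres (the critical points of index `2`). -/
  centre : ι → X
  mem_maximalAtlas : ∀ j, chart j ∈ IsManifold.maximalAtlas (𝓡 4) ∞ X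
  mem_source : ∀ j, centre j ∈ (chart j).source
  apply_centre : ∀ j, f (centre j) = a + η
  apply_eq : ∀ j, ∀ q ∈ (chart j).source,
    f q = f (centre j) + milnorQuadratic 2 (chart j q - chart j (centre j))
  disjoint : Pairwise fun i j => Disjoint (chart i).source (chart j).source
  /-- A common chart radius. -/
  R : ℝ
  R_pos : 0 < R
  closedBall_subset : ∀ j, closedBall (chart j (centre j)) R ⊆ (chart j).target
  eta_pos : 0 < η
  eta_le : 4 * η ≤ R ^ 2

namespace TubeSystem

variable [IsManifold (𝓡 4) ∞ X] {f : X → ℝ} {a η : ℝ} {ι : Type} [Fintype ι]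
  (T : TubeSystem f a η ι)

/-- The centred Milnor coordinate `z_j(q) = e_j q - e_j c_j`. [cite: MilnorHCobordism1965, Def. 3.1] -/
def centred (j : ι) (q : X) : 𝔼 4 := T.chart j q - T.chart j (T.centre j)

/-- Unfolding of `centred`. [folklore] -/
theorem centred_apply (j : ι) (q : X) : T.centred j q = T.chart j q - T.chart j (T.centre j) := rfl

/-- On the chart domain, `f - a = η + Q₂(z_j)`. [cite: MilnorHCobordism1965, Def. 3.1] -/
theorem apply_sub_eq (j : ι) {q : X} (hq : q ∈ (T.chart j).source) :
    f q - a = η + milnorQuadratic 2 (T.centred j q) := by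
  rw [T.apply_eq j q hq, T.apply_centre, centred_apply]; ring

/-- On the chart domain, `|x(q)|² = η + |y(q)|² - (f q - a)`. [cite: MilnorHCobordism1965, Def. 3.1] -/
theorem nsq_proj_centred_eq (j : ι) {q : X} (hq : q ∈ (T.chart j).source) :
    nsq (proj (T.centred j q)) = η + bsq (T.centred j q) - (f q - a) := by
  rw [T.apply_sub_eq j hq, milnorQuadratic_two_apply, nsq_proj, bsq_apply]; ring

/-- The centred coordinate is smooth on the chart domain. [folklore] -/
theorem contMDiffAt_centred (j : ι) {q : X} (hq : q ∈ (T.chart j).source) :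
    ContMDiffAt (𝓡 4) 𝓘(ℝ, 𝔼 4) ∞ (T.centred j) q := by
  have h1 : ContMDiffAt (𝓡 4) (𝓡 4) ∞ (T.chart j) q :=
    (contMDiffOn_of_mem_maximalAtlas (T.mem_maximalAtlas j)).contMDiffAt
      ((T.chart j).open_source.mem_nhds hq)
  exact h1.sub contMDiffAt_const

/-- The centred coordinate is continuous on the chart domain. [folklore] -/
theorem continuousAt_centred (j : ι) {q : X} (hq : q ∈ (T.chart j).source) :
    ContinuousAt (T.centred j) q :=
  (T.contMDiffAt_centred j hq).continuousAt

/-! ### The globalised Heegaard germ -/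

/-- The local piece `χ(f - a) (Ψ(𝒯(z_j)) - (1 + 4δ))` on the `j`-th chart domain. [cite: GayKirby2016, §4, Lemma 14] -/
def localPiece (ε κ δ : ℝ) (j : ι) (q : X) : ℝ :=
  cut η (f q - a) * (sat δ (tube ε κ η (T.centred j q)) - (1 + 4 * δ))

/-- The local piece extended by zero off the chart domain. [folklore] -/
def piece (ε κ δ : ℝ) (j : ι) : X → ℝ := (T.chart j).source.indicator (T.localPiece ε κ δ j)

/-- **The globalised Heegaard germ** `F = (1 + 4δ) + Σ_j piece_j`. [cite: GayKirby2016, §4, Lemma 14] -/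
def heegaardFn (ε κ δ : ℝ) (q : X) : ℝ := (1 + 4 * δ) + ∑ j, T.piece ε κ δ j q

variable {ε κ δ : ℝ}

/-- Off its chart domain the `j`-th piece vanishes. [folklore] -/
theorem piece_of_notMem {j : ι} {q : X} (hq : q ∉ (T.chart j).source) : T.piece ε κ δ j q = 0 :=
  indicator_of_notMem hq _

/-- On its chart domain the `j`-th piece is the local piece. [folklore] -/
theorem piece_of_mem {j : ι} {q : X} (hq : q ∈ (T.chart j).source) :
    T.piece ε κ δ j q = T.localPiece ε κ δ j q :=
  indicator_of_mem hq _

/-- On the `j`-th chart domain the other pieces vanish, so `F = (1 + 4δ) + piece_j`. [folklore] -/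
theorem heegaardFn_of_mem {j : ι} {q : X} (hq : q ∈ (T.chart j).source) :
    T.heegaardFn ε κ δ q = (1 + 4 * δ) + T.localPiece ε κ δ j q := by
  rw [heegaardFn, Finset.sum_eq_single j, T.piece_of_mem hq]
  · intro i _ hij
    exact T.piece_of_notMem fun hi => (T.disjoint hij).le_bot ⟨hi, hq⟩
  · intro h; exact absurd (Finset.mem_univ j) h

/-- Off all chart domains `F = 1 + 4δ`. [folklore] -/
theorem heegaardFn_of_forall_notMem {q : X} (hq : ∀ j, q ∉ (T.chart j).source) :
    T.heegaardFn ε κ δ q = 1 + 4 * δ := by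
  rw [heegaardFn, Finset.sum_eq_zero fun j _ => T.piece_of_notMem (hq j), add_zero]

/-! ### Smoothness -/

omit [IsManifold (𝓡 4) ∞ X] in
/-- A smooth one-variable function of a smooth function is smooth (pointwise). [folklore] -/
theorem contMDiffAt_real_comp {m : WithTop ℕ∞} {g : ℝ → ℝ} (hg : ContDiff ℝ m g) {u : X → ℝ}
    {q : X} (hu : ContMDiffAt (𝓡 4) 𝓘(ℝ, ℝ) m u q) :
    ContMDiffAt (𝓡 4) 𝓘(ℝ, ℝ) m (fun q' => g (u q')) q :=
  hg.contDiffAt.contMDiffAt.comp q hu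

/-- **The local piece is smooth on its chart domain**: off `{x = 0}` it is a product of smooth
functions, and on the open set `{f - a > η/2}` (a neighbourhood of `{x = 0}`, where
`f - a = η + |y|²`) the cut-off `χ(f - a)` vanishes identically. [cite: GayKirby2016, §4, Lemma 14] -/
theorem contMDiffAt_localPiece (hf : ContMDiff (𝓡 4) 𝓘(ℝ, ℝ) ∞ f) (j : ι) {q : X}
    (hq : q ∈ (T.chart j).source) : ContMDiffAt (𝓡 4) 𝓘(ℝ, ℝ) ∞ (T.localPiece ε κ δ j) q := by
  by_cases hz : nsq (proj (T.centred j q)) = 0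
  · -- near `q` the cut-off vanishes
    have hfa : η / 2 < f q - a := by
      have h := T.nsq_proj_centred_eq j hq
      rw [hz] at h
      linarith [bsq_nonneg (T.centred j q), T.eta_pos]
    have hopen : IsOpen {q' : X | η / 2 < f q' - a} :=
      isOpen_lt continuous_const (hf.continuous.sub continuous_const)
    have hev : T.localPiece ε κ δ j =ᶠ[𝓝 q] fun _ => 0 := by
      filter_upwards [hopen.mem_nhds hfa] with q' hq'
      have : cut η (f q' - a) = 0 :=
        cut_of_le_abs T.eta_pos (le_trans hq'.le (le_abs_self _))
      simp [localPiece, this]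
    exact contMDiffAt_const.congr_of_eventuallyEq hev
  · have h1 : ContMDiffAt (𝓡 4) 𝓘(ℝ, ℝ) ∞ (fun q' => cut η (f q' - a)) q :=
      contMDiffAt_real_comp (contDiff_cut η) ((hf q).sub contMDiffAt_const)
    have h2 : ContMDiffAt (𝓡 4) 𝓘(ℝ, ℝ) ∞ (fun q' => tube ε κ η (T.centred j q')) q :=
      (contDiffAt_tube ε κ η hz).contMDiffAt.comp q (T.contMDiffAt_centred j hq)
    have h3 : ContMDiffAt (𝓡 4) 𝓘(ℝ, ℝ) ∞ (fun q' => sat δ (tube ε κ η (T.centred j q'))) q :=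
      contMDiffAt_real_comp (contDiff_sat δ) h2
    exact h1.mul (h3.sub contMDiffAt_const)

/-- The radius `ρ` with `|y|² < ρ²` on the support of a piece: `ρ² = 2(5δ + ε)/κ`. [folklore] -/
def rhoSq (ε κ δ : ℝ) : ℝ := 2 * (5 * δ + ε) / κ

/-- **Where a local piece does not vanish**: `|f q - a| < η/2` and `𝒯(z) < 1 + 5δ`, whence
`|x|² > η/2`, `|y|² < ρ²` and `‖z‖² < 3η/2 + 2ρ²`. [cite: GayKirby2016, §4, Lemma 14] -/
theorem norm_sq_lt_of_localPiece_ne_zero (hε : 0 ≤ ε) (hκ : 0 < κ) (hδ : 0 < δ) (j : ι) {q : X}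
    (hq : q ∈ (T.chart j).source) (h : T.localPiece ε κ δ j q ≠ 0) :
    bsq (T.centred j q) < rhoSq ε κ δ ∧ ‖T.centred j q‖ ^ 2 < 3 * η / 2 + 2 * rhoSq ε κ δ := by
  set z := T.centred j q with hz
  have hcut : cut η (f q - a) ≠ 0 := fun h0 => h (by rw [localPiece, h0, zero_mul])
  have hsat : sat δ (tube ε κ η z) ≠ 1 + 4 * δ := fun h0 => h (by rw [localPiece, ← hz, h0, sub_self, mul_zero])
  have hfa : |f q - a| < η / 2 := abs_lt_of_cut_ne_zero T.eta_pos hcut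
  have htube : tube ε κ η z < 1 + 5 * δ := by
    by_contra h'
    exact hsat (sat_of_ge hδ (not_lt.1 h'))
  have hx : nsq (proj z) = η + bsq z - (f q - a) := T.nsq_proj_centred_eq j hq
  have hlow := (tube_sub_mem_Icc hε κ η z).1
  rw [← nsq_proj, ← bsq_apply] at hlow
  have hxgt : η / 2 < nsq (proj z) := by rw [hx]; linarith [(abs_lt.1 hfa).2, bsq_nonneg z]
  have hb0 := bsq_nonneg z
  -- `(κ/η) |x|² |y|² < 5δ + ε` and `|x|² > η/2`
  have hprod : κ / η * nsq (proj z) * bsq z < 5 * δ + ε := by linarith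
  have hb : bsq z < rhoSq ε κ δ := by
    rw [rhoSq, lt_div_iff₀ hκ]
    have h1 : κ / η * (η / 2) * bsq z ≤ κ / η * nsq (proj z) * bsq z :=
      mul_le_mul_of_nonneg_right (mul_le_mul_of_nonneg_left hxgt.le (by
        have := T.eta_pos; positivity)) hb0
    have h2 : κ / η * (η / 2) * bsq z = κ * bsq z / 2 := by
      have hη : η ≠ 0 := T.eta_pos.ne'
      field_simp
    rw [h2] at h1
    linarith
  refine ⟨hb, ?_⟩
  have hnorm : ‖z‖ ^ 2 = nsq (proj z) + bsq z := by
    rw [EuclideanSpace.real_norm_sq_eq, Fin.sum_univ_four, nsq_proj, bsq_apply]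
    ring
  rw [hnorm, hx]
  linarith [(abs_lt.1 hfa).1]

/-- The support radius `R' = √(3η/2 + 2ρ²)`. [folklore] -/
def suppRadius (η ε κ δ : ℝ) : ℝ := Real.sqrt (3 * η / 2 + 2 * rhoSq ε κ δ)

/-- The compact set `K_j = e_j⁻¹(B̄(e_j c_j, R'))` containing the support of the `j`-th piece.
[folklore] -/
def suppSet (ε κ δ : ℝ) (j : ι) : Set X :=
  (T.chart j).symm '' closedBall (T.chart j (T.centre j)) (suppRadius η ε κ δ)

/-- Under the smallness hypothesis `3η/2 + 2ρ² ≤ R²` (i.e. `R' ≤ R`), `B̄(e_j c_j, R') ⊆ target e_j`.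
[folklore] -/
theorem closedBall_suppRadius_subset (hs : 3 * η / 2 + 2 * rhoSq ε κ δ ≤ T.R ^ 2) (j : ι) :
    closedBall (T.chart j (T.centre j)) (suppRadius η ε κ δ) ⊆ (T.chart j).target := by
  refine (closedBall_subset_closedBall ?_).trans (T.closedBall_subset j)
  rw [suppRadius, Real.sqrt_le_left T.R_pos.le]
  exact hs

/-- `K_j` is compact. [folklore] -/
theorem isCompact_suppSet (hs : 3 * η / 2 + 2 * rhoSq ε κ δ ≤ T.R ^ 2) (j : ι) : IsCompact (T.suppSet ε κ δ j) :=
  (isCompact_closedBall _ _).image_of_continuousOn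
    ((T.chart j).continuousOn_symm.mono (T.closedBall_suppRadius_subset hs j))

/-- `K_j ⊆ source e_j`. [folklore] -/
theorem suppSet_subset_source (hs : 3 * η / 2 + 2 * rhoSq ε κ δ ≤ T.R ^ 2) (j : ι) :
    T.suppSet ε κ δ j ⊆ (T.chart j).source := by
  rintro _ ⟨w, hw, rfl⟩
  exact (T.chart j).map_target (T.closedBall_suppRadius_subset hs j hw)

variable [T2Space X] in
/-- **The support of the `j`-th piece lies in `K_j`.** [cite: GayKirby2016, §4, Lemma 14] -/
theorem tsupport_piece_subset (hs : 3 * η / 2 + 2 * rhoSq ε κ δ ≤ T.R ^ 2) (hε : 0 ≤ ε) (hκ : 0 < κ) (hδ : 0 < δ)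
    (j : ι) : tsupport (T.piece ε κ δ j) ⊆ T.suppSet ε κ δ j := by
  have hK : IsClosed (T.suppSet ε κ δ j) := (T.isCompact_suppSet hs j).isClosed
  refine closure_minimal (fun q hq => ?_) hK
  rw [mem_support] at hq
  have hqs : q ∈ (T.chart j).source := by
    by_contra h'; exact hq (T.piece_of_notMem h')
  rw [T.piece_of_mem hqs] at hq
  have hnorm := (T.norm_sq_lt_of_localPiece_ne_zero hε hκ hδ j hqs hq).2
  refine ⟨T.chart j q, ?_, (T.chart j).left_inv hqs⟩
  rw [mem_closedBall, dist_eq_norm, ← T.centred_apply j q, suppRadius]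
  exact Real.le_sqrt_of_sq_le hnorm.le

variable [T2Space X] in
/-- **Each piece is smooth on `X`.** [cite: GayKirby2016, §4, Lemma 14] -/
theorem contMDiff_piece (hf : ContMDiff (𝓡 4) 𝓘(ℝ, ℝ) ∞ f) (hs : 3 * η / 2 + 2 * rhoSq ε κ δ ≤ T.R ^ 2) (hε : 0 ≤ ε)
    (hκ : 0 < κ) (hδ : 0 < δ) (j : ι) : ContMDiff (𝓡 4) 𝓘(ℝ, ℝ) ∞ (T.piece ε κ δ j) := by
  refine contMDiff_of_tsupport fun q hq => ?_
  have hqs : q ∈ (T.chart j).source :=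
    T.suppSet_subset_source hs j (T.tsupport_piece_subset hs hε hκ hδ j hq)
  have hev : T.piece ε κ δ j =ᶠ[𝓝 q] T.localPiece ε κ δ j :=
    Filter.eventuallyEq_of_mem ((T.chart j).open_source.mem_nhds hqs) fun q' hq' => T.piece_of_mem hq'
  exact (T.contMDiffAt_localPiece hf j hqs).congr_of_eventuallyEq hev

variable [T2Space X] in
/-- **The globalised Heegaard germ is smooth on `X`.** [cite: GayKirby2016, §4, Lemma 14] -/
theorem contMDiff_heegaardFn (hf : ContMDiff (𝓡 4) 𝓘(ℝ, ℝ) ∞ f) (hs : 3 * η / 2 + 2 * rhoSq ε κ δ ≤ T.R ^ 2)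
    (hε : 0 ≤ ε) (hκ : 0 < κ) (hδ : 0 < δ) : ContMDiff (𝓡 4) 𝓘(ℝ, ℝ) ∞ (T.heegaardFn ε κ δ) := by
  have hsum : ContMDiff (𝓡 4) 𝓘(ℝ, ℝ) ∞ fun q => ∑ j, T.piece ε κ δ j q :=
    contMDiff_finsetSum fun j _ => T.contMDiff_piece hf hs hε hκ hδ j
  exact contMDiff_const.add hsum

/-! ### Germs along the level `Y = f⁻¹(a)` -/

/-- **Near a point of `Y` in the `j`-th chart, `F = Ψ(𝒯(z_j))`.** [cite: GayKirby2016, §4, Lemma 14] -/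
theorem eventuallyEq_sat_tube (hf : ContMDiff (𝓡 4) 𝓘(ℝ, ℝ) ∞ f) (j : ι) {y : X} (hy : f y = a)
    (hys : y ∈ (T.chart j).source) :
    T.heegaardFn ε κ δ =ᶠ[𝓝 y] fun q => sat δ (tube ε κ η (T.centred j q)) := by
  have hopen : IsOpen {q : X | |f q - a| < η / 4} := by
    have : Continuous fun q => |f q - a| := (hf.continuous.sub continuous_const).abs
    exact isOpen_lt this continuous_const
  have hy' : y ∈ {q : X | |f q - a| < η / 4} := by
    simp only [mem_setOf_eq, hy, sub_self, abs_zero]; linarith [T.eta_pos]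
  filter_upwards [(T.chart j).open_source.mem_nhds hys, hopen.mem_nhds hy'] with q hq hqa
  rw [T.heegaardFn_of_mem hq, localPiece, cut_of_abs_le T.eta_pos (le_of_lt hqa)]
  ring

/-- **Near a point of `Y` in the `j`-th chart with `𝒯(z_j) < 1 + 7δ/2`, `F = 𝒯(z_j)`** (the tube
germ of `TrisectionsHeegaardGerm.lean`). [cite: GayKirby2016, §4, Lemma 14] -/
theorem eventuallyEq_tube (hf : ContMDiff (𝓡 4) 𝓘(ℝ, ℝ) ∞ f) (hδ : 0 < δ) (j : ι) {y : X}
    (hy : f y = a) (hys : y ∈ (T.chart j).source)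
    (hlt : tube ε κ η (T.centred j y) < 1 + 7 / 2 * δ) :
    T.heegaardFn ε κ δ =ᶠ[𝓝 y] fun q => tube ε κ η (T.chart j q - T.chart j (T.centre j)) := by
  have hz : nsq (proj (T.centred j y)) ≠ 0 := by
    rw [T.nsq_proj_centred_eq j hys, hy, sub_self, sub_zero]
    linarith [bsq_nonneg (T.centred j y), T.eta_pos]
  have hcont : ContinuousAt (fun q => tube ε κ η (T.centred j q)) y :=
    ((contDiffAt_tube (m := 0) ε κ η hz).continuousAt).comp (T.continuousAt_centred j hys)
  have hev : ∀ᶠ q in 𝓝 y, tube ε κ η (T.centred j q) < 1 + 7 / 2 * δ :=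
    hcont.eventually (gt_mem_nhds hlt)
  filter_upwards [T.eventuallyEq_sat_tube hf j hy hys, hev] with q hq hq'
  rw [hq, sat_of_le hδ hq'.le, centred_apply]

/-- On the level, in the `j`-th chart, where `𝒯(z_j) ≤ 1 + 7δ/2`: `F = 𝒯(z_j)` (pointwise).
[cite: GayKirby2016, §4, Lemma 14] -/
theorem heegaardFn_eq_tube (hf : ContMDiff (𝓡 4) 𝓘(ℝ, ℝ) ∞ f) (hδ : 0 < δ) (j : ι) {y : X}
    (hy : f y = a) (hys : y ∈ (T.chart j).source)
    (hle : tube ε κ η (T.centred j y) ≤ 1 + 7 / 2 * δ) :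
    T.heegaardFn ε κ δ y = tube ε κ η (T.centred j y) := by
  rw [(T.eventuallyEq_sat_tube hf j hy hys).eq_of_nhds (f := T.heegaardFn ε κ δ), sat_of_le hδ hle]

/-- On the level, in the `j`-th chart: `F = Ψ(𝒯(z_j))` (pointwise). [cite: GayKirby2016, §4, Lemma 14] -/
theorem heegaardFn_eq_sat_tube (hf : ContMDiff (𝓡 4) 𝓘(ℝ, ℝ) ∞ f) (j : ι) {y : X}
    (hy : f y = a) (hys : y ∈ (T.chart j).source) :
    T.heegaardFn ε κ δ y = sat δ (tube ε κ η (T.centred j y)) :=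
  (T.eventuallyEq_sat_tube hf j hy hys).eq_of_nhds (f := T.heegaardFn ε κ δ)

variable [T2Space X] in
/-- **Off the sets `K_j`, `F = 1 + 4δ` near the point.** [cite: GayKirby2016, §4, Lemma 14] -/
theorem eventuallyEq_const (hs : 3 * η / 2 + 2 * rhoSq ε κ δ ≤ T.R ^ 2) (hε : 0 ≤ ε) (hκ : 0 < κ) (hδ : 0 < δ)
    {y : X} (hy : ∀ j, y ∉ T.suppSet ε κ δ j) :
    T.heegaardFn ε κ δ =ᶠ[𝓝 y] fun _ => 1 + 4 * δ := by
  have h : ∀ j, ∀ᶠ q in 𝓝 y, T.piece ε κ δ j q = 0 := fun j => by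
    have : y ∉ tsupport (T.piece ε κ δ j) := fun h' =>
      hy j (T.tsupport_piece_subset hs hε hκ hδ j h')
    exact (notMem_tsupport_iff_eventuallyEq.1 this).mono fun q hq => by simpa using hq
  filter_upwards [Filter.eventually_all.2 h] with q hq
  rw [heegaardFn, Finset.sum_eq_zero fun j _ => hq j, add_zero]

variable [T2Space X] in
/-- Off all chart domains, `F = 1 + 4δ` near the point. [cite: GayKirby2016, §4, Lemma 14] -/
theorem eventuallyEq_const_of_forall_notMem (hs : 3 * η / 2 + 2 * rhoSq ε κ δ ≤ T.R ^ 2) (hε : 0 ≤ ε) (hκ : 0 < κ)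
    (hδ : 0 < δ) {y : X} (hy : ∀ j, y ∉ (T.chart j).source) :
    T.heegaardFn ε κ δ =ᶠ[𝓝 y] fun _ => 1 + 4 * δ :=
  T.eventuallyEq_const hs hε hκ hδ fun j hj => hy j (T.suppSet_subset_source hs j hj)

variable [T2Space X] in
/-- **Where `F < 1 + 7δ/2` on the level, `F` has the tube germ of one of the charts.**
[cite: GayKirby2016, §4, Lemma 14] -/
theorem exists_eventuallyEq_tube_of_lt (hf : ContMDiff (𝓡 4) 𝓘(ℝ, ℝ) ∞ f) (hs : 3 * η / 2 + 2 * rhoSq ε κ δ ≤ T.R ^ 2)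
    (hε : 0 ≤ ε) (hκ : 0 < κ) (hδ : 0 < δ) {y : X} (hy : f y = a)
    (hlt : T.heegaardFn ε κ δ y < 1 + 7 / 2 * δ) :
    ∃ j, y ∈ (T.chart j).source ∧ tube ε κ η (T.centred j y) < 1 + 7 / 2 * δ ∧
      T.heegaardFn ε κ δ =ᶠ[𝓝 y] fun q => tube ε κ η (T.chart j q - T.chart j (T.centre j)) := by
  by_cases h : ∃ j, y ∈ (T.chart j).source
  · obtain ⟨j, hj⟩ := h
    have hlt' : tube ε κ η (T.centred j y) < 1 + 7 / 2 * δ := by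
      rw [T.heegaardFn_eq_sat_tube hf j hy hj] at hlt
      exact lt_of_sat_lt hδ hlt
    exact ⟨j, hj, hlt', T.eventuallyEq_tube hf hδ j hy hj hlt'⟩
  · simp only [not_exists] at h
    have heq := (T.eventuallyEq_const_of_forall_notMem hs hε hκ hδ h).eq_of_nhds
      (f := T.heegaardFn ε κ δ)
    rw [heq] at hlt
    linarith

variable [T2Space X] in
/-- **Bounds on the level**: `1 - ε ≤ F ≤ 1 + 5δ` on `Y` (`ε ≤ 1 + 4δ`... precisely `0 ≤ ε`,
`0 < κ`, `0 < δ`). [cite: GayKirby2016, §4, Lemma 14] -/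
theorem heegaardFn_mem_Icc (hf : ContMDiff (𝓡 4) 𝓘(ℝ, ℝ) ∞ f) (hs : 3 * η / 2 + 2 * rhoSq ε κ δ ≤ T.R ^ 2)
    (hε : 0 ≤ ε) (hκ : 0 < κ) (hδ : 0 < δ) {y : X} (hy : f y = a) :
    T.heegaardFn ε κ δ y ∈ Icc (1 - ε) (1 + 5 * δ) := by
  by_cases h : ∃ j, y ∈ (T.chart j).source
  · obtain ⟨j, hj⟩ := h
    rw [T.heegaardFn_eq_sat_tube hf j hy hj]
    refine ⟨?_, sat_le hδ _⟩
    have hlow := (tube_sub_mem_Icc hε κ η (T.centred j y)).1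
    have hnn : 0 ≤ κ / η * ((T.centred j y) 0 ^ 2 + (T.centred j y) 1 ^ 2) *
        ((T.centred j y) 2 ^ 2 + (T.centred j y) 3 ^ 2) := by
      have := T.eta_pos; positivity
    have h1 : 1 - ε ≤ tube ε κ η (T.centred j y) := by linarith
    calc 1 - ε = min (1 - ε) (1 + 4 * δ) := by rw [min_eq_left (by linarith)]
      _ ≤ min (tube ε κ η (T.centred j y)) (1 + 4 * δ) := min_le_min_right _ h1
      _ ≤ _ := min_le_sat δ _
  · simp only [not_exists] at h
    rw [(T.eventuallyEq_const_of_forall_notMem hs hε hκ hδ h).eq_of_nhds (f := T.heegaardFn ε κ δ)]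
    constructor <;> linarith

/-! ### Morse data of `F|Y` below `1 + 7δ/2` -/

variable {h : IsRegularLevel (𝓡 4) f a}

variable [T2Space X] in
/-- **The critical points of `F|Y` below `1 + 7δ/2`**: such a critical point `p` lies in one of
the charts, at one of the four axis points `{y = 0, x₀x₁ = 0}` of its attaching circle; it is
nondegenerate, of index `0` with value `1 - ε` (at `x₁ = 0`) or of index `1` with value `1`
(at `x₀ = 0`). [cite: GayKirby2016, §4, Lemma 14] -/
theorem morseData_of_isMCriticalPt (hs : 3 * η / 2 + 2 * rhoSq ε κ δ ≤ T.R ^ 2) (hε : 0 < ε) (hκ : 0 < κ)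
    (hδ : 0 < δ) (p : RegularLevel h) (hlt : T.heegaardFn ε κ δ p.1 < 1 + 7 / 2 * δ)
    (hc : IsMCriticalPt (𝓡 3) (T.heegaardFn ε κ δ ∘ RegularLevel.incl h) p) :
    ∃ j, p.1 ∈ (T.chart j).source ∧ (T.centred j p.1) 2 = 0 ∧ (T.centred j p.1) 3 = 0 ∧
      (mhessian (𝓡 3) (T.heegaardFn ε κ δ ∘ RegularLevel.incl h) p).Nondegenerate ∧
      (((T.centred j p.1) 1 = 0 ∧ morseIndex (𝓡 3) (T.heegaardFn ε κ δ ∘ RegularLevel.incl h) p = 0 ∧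
          T.heegaardFn ε κ δ p.1 = 1 - ε) ∨
        ((T.centred j p.1) 0 = 0 ∧ morseIndex (𝓡 3) (T.heegaardFn ε κ δ ∘ RegularLevel.incl h) p = 1 ∧
          T.heegaardFn ε κ δ p.1 = 1)) := by
  have hf : ContMDiff (𝓡 4) 𝓘(ℝ, ℝ) ∞ f := h.contMDiff
  have hκη : 0 < κ / η := div_pos hκ T.eta_pos
  obtain ⟨j, hj, -, hgerm⟩ := T.exists_eventuallyEq_tube_of_lt hf hs hε.le hκ hδ p.2 hlt
  have ha : a < f (T.centre j) := by rw [T.apply_centre]; linarith [T.eta_pos]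
  have hax := (HeegaardGerm.isMCriticalPt_comp_incl_iff (T.mem_maximalAtlas j) (T.apply_eq j) ha
    hε.ne' hκη.ne' p hj hgerm).1 hc
  obtain ⟨h2, h3, h01⟩ := hax
  have hz : nsq (proj (T.chart j p.1 - T.chart j (T.centre j))) ≠ 0 :=
    HeegaardGerm.nsq_proj_ne_zero (T.apply_eq j) ha p hj
  refine ⟨j, hj, h2, h3, ?_⟩
  rcases mul_eq_zero.1 h01 with h0 | h1
  · -- `x₀ = 0`: index `1`, value `1`
    have h1 : (T.chart j p.1 - T.chart j (T.centre j)) 1 ≠ 0 := by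
      intro h1; apply hz; rw [nsq_proj, h0, h1]; ring
    obtain ⟨hnd, hidx⟩ := HeegaardGerm.nondegenerate_and_morseIndex_eq_one (T.mem_maximalAtlas j)
      (T.apply_eq j) ha hε hκη p hj hgerm h0 h1 h2 h3
    exact ⟨hnd, Or.inr ⟨h0, hidx, HeegaardGerm.apply_eq_of_axis₁ hgerm h0 h2 h3⟩⟩
  · -- `x₁ = 0`: index `0`, value `1 - ε`
    have h0 : (T.chart j p.1 - T.chart j (T.centre j)) 0 ≠ 0 := by
      intro h0; apply hz; rw [nsq_proj, h0, h1]; ring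
    obtain ⟨hnd, hidx⟩ := HeegaardGerm.nondegenerate_and_morseIndex_eq_zero (T.mem_maximalAtlas j)
      (T.apply_eq j) ha hε hκη p hj hgerm h0 h1 h2 h3
    exact ⟨hnd, Or.inl ⟨h1, hidx, HeegaardGerm.apply_eq_of_axis₀ hgerm h0 h1 h2 h3⟩⟩

variable [T2Space X] in
/-- Below `1 + 7δ/2`, critical points of `F|Y` are nondegenerate. [cite: GayKirby2016, §4, Lemma 14] -/
theorem nondegenerate_of_isMCriticalPt (hs : 3 * η / 2 + 2 * rhoSq ε κ δ ≤ T.R ^ 2) (hε : 0 < ε) (hκ : 0 < κ)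
    (hδ : 0 < δ) (p : RegularLevel h) (hlt : T.heegaardFn ε κ δ p.1 < 1 + 7 / 2 * δ)
    (hc : IsMCriticalPt (𝓡 3) (T.heegaardFn ε κ δ ∘ RegularLevel.incl h) p) :
    (mhessian (𝓡 3) (T.heegaardFn ε κ δ ∘ RegularLevel.incl h) p).Nondegenerate := by
  obtain ⟨j, -, -, -, hnd, -⟩ := T.morseData_of_isMCriticalPt hs hε hκ hδ p hlt hc
  exact hnd

variable [T2Space X] in
/-- Below `1 + 7δ/2`, critical points of `F|Y` have index `≤ 1`. [cite: GayKirby2016, §4, Lemma 14] -/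
theorem morseIndex_le_one_of_isMCriticalPt (hs : 3 * η / 2 + 2 * rhoSq ε κ δ ≤ T.R ^ 2) (hε : 0 < ε) (hκ : 0 < κ)
    (hδ : 0 < δ) (p : RegularLevel h) (hlt : T.heegaardFn ε κ δ p.1 < 1 + 7 / 2 * δ)
    (hc : IsMCriticalPt (𝓡 3) (T.heegaardFn ε κ δ ∘ RegularLevel.incl h) p) :
    morseIndex (𝓡 3) (T.heegaardFn ε κ δ ∘ RegularLevel.incl h) p ≤ 1 := by
  obtain ⟨j, -, -, -, -, hor⟩ := T.morseData_of_isMCriticalPt hs hε hκ hδ p hlt hc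
  rcases hor with ⟨-, h, -⟩ | ⟨-, h, -⟩ <;> omega

variable [T2Space X] in
/-- Below `1 + 7δ/2`, critical values of `F|Y` are `1 - ε` or `1`. [cite: GayKirby2016, §4, Lemma 14] -/
theorem apply_eq_of_isMCriticalPt (hs : 3 * η / 2 + 2 * rhoSq ε κ δ ≤ T.R ^ 2) (hε : 0 < ε) (hκ : 0 < κ)
    (hδ : 0 < δ) (p : RegularLevel h) (hlt : T.heegaardFn ε κ δ p.1 < 1 + 7 / 2 * δ)
    (hc : IsMCriticalPt (𝓡 3) (T.heegaardFn ε κ δ ∘ RegularLevel.incl h) p) :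
    T.heegaardFn ε κ δ p.1 = 1 - ε ∨ T.heegaardFn ε κ δ p.1 = 1 := by
  obtain ⟨j, -, -, -, -, hor⟩ := T.morseData_of_isMCriticalPt hs hε hκ hδ p hlt hc
  rcases hor with ⟨-, -, h⟩ | ⟨-, -, h⟩
  · exact Or.inl h
  · exact Or.inr h

/-- **The axis points are critical**: a point `p ∈ Y` of the `j`-th chart with `z_j(p)` on
`{y = 0, x₀ x₁ = 0}` is a critical point of `F|Y` (there `𝒯 ≤ 1 < 1 + 7δ/2`).
[cite: GayKirby2016, §4, Lemma 14] -/
theorem isMCriticalPt_of_axis (hε : 0 < ε) (hκ : 0 < κ) (hδ : 0 < δ) (p : RegularLevel h) {j : ι}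
    (hj : p.1 ∈ (T.chart j).source) (h2 : (T.centred j p.1) 2 = 0) (h3 : (T.centred j p.1) 3 = 0)
    (h01 : (T.centred j p.1) 0 * (T.centred j p.1) 1 = 0) :
    IsMCriticalPt (𝓡 3) (T.heegaardFn ε κ δ ∘ RegularLevel.incl h) p ∧
      T.heegaardFn ε κ δ p.1 < 1 + 7 / 2 * δ := by
  have hf : ContMDiff (𝓡 4) 𝓘(ℝ, ℝ) ∞ f := h.contMDiff
  have hκη : 0 < κ / η := div_pos hκ T.eta_pos
  have ha : a < f (T.centre j) := by rw [T.apply_centre]; linarith [T.eta_pos]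
  have hz : nsq (proj (T.centred j p.1)) ≠ 0 :=
    HeegaardGerm.nsq_proj_ne_zero (T.apply_eq j) ha p hj
  -- the value of the tube function there is `1 - ε` or `1`
  have hval : tube ε κ η (T.centred j p.1) ≤ 1 := by
    rcases mul_eq_zero.1 h01 with h0 | h1
    · rw [tube_apply_of_axis₁ ε κ η h0 h2 h3]
    · have h0 : (T.centred j p.1) 0 ≠ 0 := by
        intro h0; apply hz; rw [nsq_proj, h0, h1]; ring
      rw [tube_apply_of_axis₀ ε κ η h0 h1 h2 h3]; linarith
  have hlt : tube ε κ η (T.centred j p.1) < 1 + 7 / 2 * δ := by linarith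
  have hgerm := T.eventuallyEq_tube hf hδ j p.2 hj hlt
  refine ⟨(HeegaardGerm.isMCriticalPt_comp_incl_iff (T.mem_maximalAtlas j) (T.apply_eq j) ha
    hε.ne' hκη.ne' p hj hgerm).2 ⟨h2, h3, h01⟩, ?_⟩
  rw [T.heegaardFn_eq_tube hf hδ j p.2 hj hlt.le]
  exact hlt


end TubeSystem

end Literature.Topology.FourManifolds

end
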